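import Summits.RiemannHypothesis.RiemannHypothesis.Theorems.SignConeGradedFamilyDefs
import Summits.RiemannHypothesis.RiemannHypothesis.Theorems.SignConeGapRungOneLever
import Summits.RiemannHypothesis.RiemannHypothesis.Theorems.SignConeGapRungOneErasure
import Summits.RiemannHypothesis.RiemannHypothesis.Theorems.SignConeSignConeFarField

/-!
# `GapRung 1` of the gap-count ladder — the rung, assembled
(crux `SignConeInequality`, stmt-RiemannHypothesis-16301; cell `Cruxes/SignConeInequality/`, line `gap-rung-one` of the
ladder seat `planner-fwd-ladder-RiemannHypothesis-16301-0`)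

**Theorem (`gapRung_one : GapRung 1`).** For every cutoff `a > 0` and every node-nonnegative autocorrelation sum
`F = Σᵢ gᵢ ⋆ g̃ᵢ` (smooth `gᵢ` supported in `[-a, a]`) whose far-field negativity `{|t| ≥ log 2, Re F(t) < 0}` lies in at
most ONE node gap `[log n, log (n+1))`, the unit-slack prime-free inequality `-Re F(0) ≤ Re W_ar(F)` holds.

Assembly of the three registered regime stubs (here invoked through their analytic cores):
* no dirty gap: the closed far-field item `SignConeFarField` (`SignConeFarField_of`, stmt-RiemannHypothesis-16305);
* one dirty gap at `n ≤ 12`: erasure with the plain certificate `pwCert13s` (`singleGap_erasure`,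
  `SignConeGapRungOneErasure.lean`; in particular `n ≤ 1`, where the gap lies below `log 2`, and `2 ≤ n ≤ 11` = stub
  `stub_gap_small`);
* one dirty gap at `n ≥ 11`: the positive-definiteness lever (`singleGap_lever`, `SignConeGapRungOneLever.lean`;
  stubs `stub_gap_mid`, `stub_gap_large`).
Also recorded: the near-clean rung `nearCleanRung_thirteen_fifths : NearCleanRung (13/5)` (negativity only below `13/5`,
every cutoff), of which every single gap `n ≤ 12` is a sub-class, and `gapRung_one_iff` unfolding the rung to the
strategist's `StrategistR2Probes.GapRungOne` text.
-/

noncomputable section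

-- `Summit.RiemannHypothesis.RiemannHypothesis.…` repeats a namespace component by design (D-0017 layout).
set_option linter.dupNamespace false

open scoped BigOperators ComplexConjugate

namespace Summit.RiemannHypothesis.RiemannHypothesis.Theorems.SignCone

open Literature.NumberTheory.LFunctions
open Summit.RiemannHypothesis.RiemannHypothesis.Theorems.SignConeFarField (SignConeFarField_of)

/-- **One dirty node gap, any index, every cutoff** (Literature form): for Weil tests `gᵢ` and `F = Σᵢ gᵢ ⋆ g̃ᵢ`
node-nonnegative whose far-field negativity lies in `log n ≤ |t| < log (n+1)`: `-Re F(0) ≤ Re W_ar(F)`. [folklore] -/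
theorem singleGap_all {k : ℕ} {g : Fin k → ℝ → ℂ} {F : ℝ → ℂ} (n : ℕ)
    (hF : F = fun t => ∑ i, weilConv (g i) (weilReflect (g i)) t) (hg : ∀ i, IsWeilTest (g i))
    (hn : ∀ m : ℕ, 2 ≤ m → 0 ≤ (F (Real.log m)).re)
    (hgap : ∀ t : ℝ, Real.log 2 ≤ |t| → (F t).re < 0 → Real.log n ≤ |t| ∧ |t| < Real.log (n + 1)) :
    -(F 0).re ≤ (weilPolarTerm F + weilArchTerm F).re := by
  rcases le_or_gt n 12 with hle | hgt
  · exact singleGap_erasure hF hg hle hn hgap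
  · exact singleGap_lever hF hg (by omega) hn hgap

/-- **The single-gap statement at every index and cutoff** (`SingleGapAt`, `SignConeGapRungDefs`). [folklore] -/
theorem singleGapAt_all (n : ℕ) (a : ℝ) : SingleGapAt n a := by
  intro k g hg F hn hgap M
  exact singleGap_all n (g := g) (F := F) rfl (fun i => (hg i).1) hn hgap

/-- **`GapRung 1`** — rung `m = 1` of the gap-count ladder of the sign-cone criterion (far-field negativity in at most one
node gap, every cutoff). [folklore] -/
theorem gapRung_one : GapRung 1 := by
  intro a ha k g hg F hn hs M
  obtain ⟨s, hcard, hconf⟩ := hs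
  by_cases hempty : s = ∅
  · -- no dirty gap: the far-field item
    subst hempty
    have hff : ∀ t : ℝ, Real.log 2 ≤ |t| → 0 ≤ (F t).re := by
      intro t ht
      by_contra hneg
      push Not at hneg
      obtain ⟨n, hn', _⟩ := hconf t ht hneg
      simp at hn'
    exact SignConeFarField_of a ha k g hg hn hff
  · -- one dirty gap `n`
    obtain ⟨n, hnmem⟩ := Finset.nonempty_of_ne_empty hempty
    have hgap : ∀ t : ℝ, Real.log 2 ≤ |t| → (F t).re < 0 → Real.log n ≤ |t| ∧ |t| < Real.log (n + 1) := by
      intro t ht hneg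
      obtain ⟨m, hm, hmt⟩ := hconf t ht hneg
      have hmn : m = n := Finset.card_le_one.1 hcard m hm n hnmem
      subst hmn
      exact hmt
    exact singleGap_all n (g := g) (F := F) rfl (fun i => (hg i).1) hn hgap

/-- The rung unfolds to the strategist's text (`Cruxes/SignConeInequality/StrategistR2Probes.GapRungOne`, the registered
crux decl of line `gap-rung-one` up to the name of the namespace). [folklore] -/
theorem gapRung_one_iff : GapRung 1 ↔
    ∀ a : ℝ, 0 < a → ∀ (k : ℕ) (g : Fin k → ℝ → ℂ), (∀ i, (ContDiff ℝ ((⊤ : ℕ∞) : WithTop ℕ∞) (g i) ∧ HasCompactSupport (g i)) ∧ tsupport (g i) ⊆ Set.Icc (-a) a) → let F : ℝ → ℂ := fun t => ∑ i, MeasureTheory.convolution (g i) (fun u => (starRingEnd ℂ) ((g i) (-u))) (ContinuousLinearMap.mul ℂ ℂ) MeasureTheory.MeasureSpace.volume t; (∀ n : ℕ, 2 ≤ n → 0 ≤ (F (Real.log n)).re) → (∃ s : Finset ℕ, s.card ≤ 1 ∧ ∀ t : ℝ, Real.log 2 ≤ |t| → (F t).re < 0 → ∃ n ∈ s, Real.log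 n ≤ |t| ∧ |t| < Real.log (n + 1)) → let M : ℂ → ℂ := fun s => ∫ u : ℝ, F u * Complex.exp ((s - 1 / 2) * u); -(F 0).re ≤ (M 0 + M 1 + ((1 / (2 * Real.pi) : ℂ) * (∫ t : ℝ, M (1 / 2 + t * Complex.I) * ((Complex.digamma (1 / 4 + t / 2 * Complex.I)).re : ℂ)) - F 0 * (Real.log Real.pi : ℂ))).re :=
  Iff.rfl

/-- **The near-clean rung `13/5`** of the cell's graded families (`NearCleanRung`, `SignConeGradedFamilyDefs`): negativity of
`Re F` confined to `|t| < 13/5`, every cutoff — erasure with the plain certificate `pwCert13s`. [folklore] -/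
theorem nearCleanRung_thirteen_fifths : NearCleanRung (13 / 5) := by
  intro a _ha k g hg F hn hclean M
  exact unitSlack_of_clean_beyond_thirteen_fifths (g := g) (F := F) rfl (fun i => (hg i).1) hn
    (fun x hx => hclean x hx.le)

end Summit.RiemannHypothesis.RiemannHypothesis.Theorems.SignCone

end
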